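import Literature.Computability.MetaComplexity.SmolenskyProperty
import Literature.Computability.MetaComplexity.LowDegreeClosure
import Literature.Computability.MetaComplexity.RazborovSmolenskyPoly
import Literature.Computability.MetaComplexity.SmolenskyCorrelationRestrict
import Mathlib.Data.Nat.Choose.Sum
import Summits.QuantumAdvantage.AdviceFreeQNC0.WalkCoordinates
import Summits.QuantumAdvantage.AdviceFreeQNC0.RingHardOdd
import Mathlib.Algebra.BigOperators.Pi
import HarnessLib

/-!
# Sparse-active strategies lose the ring game — part 1: half-cube lemma and comb arithmetic

Support library for ExactnessDial 27380 / 27432 (decomp-qadv lens 2, g8, node «SparseDial»).  This part: the exact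
half-cube lemma over `ZMod 3` (`eq_zero_of_vanish_oddHalf/evenHalf`: degree `≤ Δ` on `{0,1}^{2Δ+1}` and vanishing on
a parity half force `0`, from `Smolensky.map_mulLeft_parity_sup_eq_top` + the dimension count `Σ_{j≤Δ} C(2Δ+1,j) = 4^Δ`),
its level-set form `eq_zero_of_vanish_level` on `{0,1}^m × {0,1}^m`, and the comb word's parity / mod-3 bookkeeping
(`combPar`, `bx_eq_ev`, `combSum_mod_three`).  Parts 2–3: `RingSparseActivePattern`, `RingSparseActive`.
-/

set_option linter.dupNamespace false -- D-0017: single-problem summit ⇒ QuantumAdvantage.QuantumAdvantage by design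

namespace Summit.QuantumAdvantage.QuantumAdvantage.Theorems.RingSparseActive

open Finset Module Literature.Computability.MetaComplexity Literature.Computability.MetaComplexity.Smolensky


/-- `dim lowDeg (2Δ+1) Δ = 4^Δ`. -/
theorem finrank_lowDeg_half (Δ : ℕ) :
    finrank (ZMod 3) (lowDeg (ZMod 3) (2 * Δ + 1) ((2 * Δ + 1) / 2)) = 4 ^ Δ := by
  have h : (2 * Δ + 1) / 2 = Δ := by omega
  rw [h, finrank_lowDeg, Nat.sum_range_choose_halfway]

/-- In dimension `2Δ+1`: `ḡ·L ⊓ L = ⊥` for `L = lowDeg Δ` (exact dimension count). -/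
theorem map_parity_inf_eq_bot (Δ : ℕ) :
    (lowDeg (ZMod 3) (2 * Δ + 1) ((2 * Δ + 1) / 2)).map
        (LinearMap.mulLeft (ZMod 3) (pmMono (ZMod 3) univ)) ⊓
      lowDeg (ZMod 3) (2 * Δ + 1) ((2 * Δ + 1) / 2) = ⊥ := by
  have hodd : Odd (2 * Δ + 1) := ⟨Δ, rfl⟩
  have h2 : (2 : ZMod 3) ≠ 0 := by decide
  have htop := map_mulLeft_parity_sup_eq_top (F := ZMod 3) (n := 2 * Δ + 1) hodd h2
  have hmap : finrank (ZMod 3) ((lowDeg (ZMod 3) (2 * Δ + 1) ((2 * Δ + 1) / 2)).map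
        (LinearMap.mulLeft (ZMod 3) (pmMono (ZMod 3) univ))) =
      finrank (ZMod 3) (lowDeg (ZMod 3) (2 * Δ + 1) ((2 * Δ + 1) / 2)) := by
    rw [← coe_mulEquiv _ (pmMono_mul_self univ), LinearEquiv.finrank_map_eq]
  have hdim := Submodule.finrank_sup_add_finrank_inf_eq
    ((lowDeg (ZMod 3) (2 * Δ + 1) ((2 * Δ + 1) / 2)).map
        (LinearMap.mulLeft (ZMod 3) (pmMono (ZMod 3) univ)))
    (lowDeg (ZMod 3) (2 * Δ + 1) ((2 * Δ + 1) / 2))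
  rw [htop, finrank_top, finrank_cubeFn, hmap, finrank_lowDeg_half] at hdim
  have h4 : (2 : ℕ) ^ (2 * Δ + 1) = 2 * 4 ^ Δ := by
    rw [pow_succ, pow_mul]; norm_num; ring
  rw [h4] at hdim
  exact Submodule.finrank_eq_zero.1 (by omega)

/-- **Exact half-cube lemma (odd half).** On `{0,1}^{2Δ+1}`, a function of degree `≤ Δ` vanishing on
every point with an odd number of `true`s is zero. -/
theorem eq_zero_of_vanish_oddHalf (Δ : ℕ) {g : CubeFn (ZMod 3) (2 * Δ + 1)}
    (hg : g ∈ lowDeg (ZMod 3) (2 * Δ + 1) ((2 * Δ + 1) / 2))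
    (hv : ∀ b : Fin (2 * Δ + 1) → Bool, Odd (univ.filter fun i => b i = true).card → g b = 0) :
    g = 0 := by
  have hmem : g ∈ (lowDeg (ZMod 3) (2 * Δ + 1) ((2 * Δ + 1) / 2)).map
        (LinearMap.mulLeft (ZMod 3) (pmMono (ZMod 3) univ)) ⊓
      lowDeg (ZMod 3) (2 * Δ + 1) ((2 * Δ + 1) / 2) := by
    refine Submodule.mem_inf.2 ⟨?_, hg⟩
    refine Submodule.mem_map.2 ⟨g, hg, ?_⟩
    rw [LinearMap.mulLeft_apply]
    funext b
    rw [Pi.mul_apply, pmMono_univ_apply]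
    by_cases ho : Odd (univ.filter fun i => b i = true).card
    · rw [if_pos ho, hv b ho, mul_zero]
    · rw [if_neg ho, one_mul]
  rw [map_parity_inf_eq_bot] at hmem
  exact (Submodule.mem_bot (R := ZMod 3)).1 hmem

/-- **Exact half-cube lemma (even half).** Same with the even half. -/
theorem eq_zero_of_vanish_evenHalf (Δ : ℕ) {g : CubeFn (ZMod 3) (2 * Δ + 1)}
    (hg : g ∈ lowDeg (ZMod 3) (2 * Δ + 1) ((2 * Δ + 1) / 2))
    (hv : ∀ b : Fin (2 * Δ + 1) → Bool, ¬ Odd (univ.filter fun i => b i = true).card → g b = 0) :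
    g = 0 := by
  have hmem : g ∈ (lowDeg (ZMod 3) (2 * Δ + 1) ((2 * Δ + 1) / 2)).map
        (LinearMap.mulLeft (ZMod 3) (pmMono (ZMod 3) univ)) ⊓
      lowDeg (ZMod 3) (2 * Δ + 1) ((2 * Δ + 1) / 2) := by
    refine Submodule.mem_inf.2 ⟨?_, hg⟩
    refine Submodule.mem_map.2 ⟨-g, Submodule.neg_mem _ hg, ?_⟩
    rw [LinearMap.mulLeft_apply]
    funext b
    rw [Pi.mul_apply, pmMono_univ_apply, Pi.neg_apply]
    by_cases ho : Odd (univ.filter fun i => b i = true).card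
    · rw [if_pos ho]; ring
    · rw [if_neg ho, hv b ho]; ring
  rw [map_parity_inf_eq_bot] at hmem
  exact (Submodule.mem_bot (R := ZMod 3)).1 hmem

/-! ## Stage 2: vanishing on the level sets of `ev u + ev a` in `{0,1}^m × {0,1}^m`, `m = 2Δ+1` -/

/-- `ev u = 1` if `u` has an even number of `true`s, else `0`. -/
def ev {m : ℕ} (u : Fin m → Bool) : ℕ := if Odd (univ.filter fun i => u i = true).card then 0 else 1

/-- `ev u ≤ 1`. -/
theorem ev_le_one {m : ℕ} (u : Fin m → Bool) : ev u ≤ 1 := by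
  unfold ev; split <;> omega

/-- `ev u = 0` iff the number of `true` bits is even. -/
theorem ev_eq_zero_iff {m : ℕ} (u : Fin m → Bool) :
    ev u = 0 ↔ Odd (univ.filter fun i => u i = true).card := by
  unfold ev; split <;> simp_all

/-- `ev u = 1` iff the number of `true` bits is odd. -/
theorem ev_eq_one_iff {m : ℕ} (u : Fin m → Bool) :
    ev u = 1 ↔ ¬ Odd (univ.filter fun i => u i = true).card := by
  unfold ev; split <;> simp_all

/-- Slices in the first block keep the degree. -/
theorem slice_left_mem {m D : ℕ} {h : CubeFn (ZMod 3) (m + m)} (hh : h ∈ lowDeg (ZMod 3) (m + m) D)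
    (a : Fin m → Bool) : (fun u : Fin m → Bool => h (Fin.append u a)) ∈ lowDeg (ZMod 3) m D :=
  comp_append_mem_lowDeg hh a

/-- Slices in the second block keep the degree. -/
theorem slice_right_mem {m D : ℕ} {h : CubeFn (ZMod 3) (m + m)} (hh : h ∈ lowDeg (ZMod 3) (m + m) D)
    (u : Fin m → Bool) : (fun a : Fin m → Bool => h (Fin.append u a)) ∈ lowDeg (ZMod 3) m D := by
  refine comp_subst_mem_lowDeg (fun a => Fin.append u a) (fun i => ?_) hh
  induction i using Fin.addCases with
  | left j => exact Or.inl ⟨u j, fun a => by rw [Fin.append_left]⟩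
  | right j => exact Or.inr ⟨j, fun a => by rw [Fin.append_right]⟩

/-- **Level-set vanishing.** On `{0,1}^m × {0,1}^m` (`m = 2Δ+1`), a function of degree `≤ Δ` that
vanishes on a level set `{ev u + ev a = s}` (`s ≤ 2`) vanishes identically. -/
theorem eq_zero_of_vanish_level (Δ s : ℕ) (hs : s ≤ 2)
    {h : CubeFn (ZMod 3) ((2 * Δ + 1) + (2 * Δ + 1))}
    (hh : h ∈ lowDeg (ZMod 3) ((2 * Δ + 1) + (2 * Δ + 1)) ((2 * Δ + 1) / 2))
    (hv : ∀ (u a : Fin (2 * Δ + 1) → Bool), ev u + ev a = s → h (Fin.append u a) = 0) :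
    h = 0 := by
  -- every slice `u ↦ h (u ++ a)` with `ev a ≤ s ≤ ev a + 1` vanishes
  have hslice : ∀ a : Fin (2 * Δ + 1) → Bool, ev a ≤ s → s ≤ ev a + 1 →
      ∀ u, h (Fin.append u a) = 0 := by
    intro a h1 h2 u
    have hmem := slice_left_mem hh a
    rcases Nat.eq_or_lt_of_le h1 with heq | hlt
    · -- `s = ev a`: need `ev u = 0`, the odd half
      have hz := eq_zero_of_vanish_oddHalf Δ hmem (fun b hb => hv b a (by
        rw [(ev_eq_zero_iff b).2 hb]; omega))
      exact congrFun hz u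
    · -- `s = ev a + 1`: need `ev u = 1`, the even half
      have hz := eq_zero_of_vanish_evenHalf Δ hmem (fun b hb => hv b a (by
        rw [(ev_eq_one_iff b).2 hb]; omega))
      exact congrFun hz u
  funext w
  rw [Pi.zero_apply, ← Fin.append_castAdd_natAdd (f := w)]
  set u := fun i => w (Fin.castAdd (2 * Δ + 1) i)
  set a := fun i => w (Fin.natAdd (2 * Δ + 1) i)
  have hau := ev_le_one a
  have huu := ev_le_one u
  by_cases hok : ev a ≤ s ∧ s ≤ ev a + 1
  · exact hslice a hok.1 hok.2 u
  · -- the slice `a' ↦ h (u ++ a')` vanishes on a half, hence everywhere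
    have hmem := slice_right_mem hh u
    rcases Nat.lt_or_ge s 1 with hs0 | hs1
    · -- `s = 0`, `ev a = 1`: the slice in `a'` vanishes on `{ev a' = 0}` (all `u'`), the odd half
      have hz := eq_zero_of_vanish_oddHalf Δ hmem (fun b hb => by
        have hb0 := (ev_eq_zero_iff b).2 hb
        exact hslice b (by omega) (by omega) u)
      exact congrFun hz a
    · -- `s = 2`, `ev a = 0`: the slice in `a'` vanishes on `{ev a' = 1}`, the even half
      have hz := eq_zero_of_vanish_evenHalf Δ hmem (fun b hb => by
        have hb1 := (ev_eq_one_iff b).2 hb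
        exact hslice b (by omega) (by omega) u)
      exact congrFun hz a

/-! ## Stage 3: the double comb and its walk coordinates -/

section Comb

open Summit.QuantumAdvantage.AdviceFreeQNC0 Literature.Computability.QuantumComplexity
  Literature.Computability.QuantumComplexity.RingHLF

/-- Extension of a block of comb variables by `true` beyond the block. -/
def ext {m : ℕ} (u : Fin m → Bool) (j : ℕ) : Bool := if h : j < m then u ⟨j, h⟩ else true

/-- `ext u j = u j` inside the range. -/
theorem ext_of_lt {m : ℕ} (u : Fin m → Bool) {j : ℕ} (h : j < m) : ext u j = u ⟨j, h⟩ := by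
  simp [ext, h]

/-- `ext u j = false` outside the range. -/
theorem ext_of_le {m : ℕ} (u : Fin m → Bool) {j : ℕ} (h : m ≤ j) : ext u j = true := by
  simp [ext, Nat.not_lt.2 h]

/-- The comb word of size `m` on the variables `y`: positions `r = 0 … 6m`; openings (first copy of
the literal `y j`) at `r = 3j`, a plain `1` at `r = 3m`, closings (second copy of `y j`) at
`r = 3m + 1 + 3j`; every other bit is `1`. -/
def combBit (m : ℕ) (y : ℕ → Bool) (r : ℕ) : Bool :=
  if r ≤ 3 * m then (if r % 3 = 0 then y (r / 3) else true)
  else (if (r - (3 * m + 1)) % 3 = 0 then y ((r - (3 * m + 1)) / 3) else true)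

/-- xor-accumulated zero-parity `⊕_{j < n} ¬ y j`. -/
def xorUpTo (y : ℕ → Bool) : ℕ → Bool
  | 0 => false
  | n + 1 => xor (xorUpTo y n) (!y n)

/-- Closed form of the zero-parity of the comb word after position `r` (incoming parity `0`). -/
def combPar (m : ℕ) (y : ℕ → Bool) (r : ℕ) : Bool :=
  if r ≤ 3 * m then xorUpTo y (r / 3 + 1)
  else xor (xorUpTo y (m + 1)) (xorUpTo y ((r - (3 * m + 1)) / 3 + 1))

/-- The comb parity before position `0`. -/
theorem combPar_zero (m : ℕ) (y : ℕ → Bool) : combPar m y 0 = !combBit m y 0 := by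
  simp [combPar, combBit, xorUpTo]

/-- One-step recursion of the comb parity. -/
theorem combPar_succ (m : ℕ) (y : ℕ → Bool) (r : ℕ) :
    combPar m y (r + 1) = xor (combPar m y r) (!combBit m y (r + 1)) := by
  unfold combPar combBit
  by_cases h1 : r + 1 ≤ 3 * m
  · have h0 : r ≤ 3 * m := by omega
    rw [if_pos h1, if_pos h0, if_pos h1]
    by_cases hmod : (r + 1) % 3 = 0
    · rw [if_pos hmod]
      have e1 : (r + 1) / 3 + 1 = r / 3 + 1 + 1 := by omega
      have e2 : (r + 1) / 3 = r / 3 + 1 := by omega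
      rw [e1, e2]; rfl
    · rw [if_neg hmod]
      have e1 : (r + 1) / 3 = r / 3 := by omega
      rw [e1, Bool.not_true, Bool.xor_false]
  · rw [if_neg h1, if_neg h1]
    by_cases h0 : r ≤ 3 * m
    · rw [if_pos h0]
      have e1 : r + 1 - (3 * m + 1) = 0 := by omega
      have e2 : r / 3 + 1 = m + 1 := by omega
      rw [e1, e2]
      simp [xorUpTo]
    · rw [if_neg h0]
      by_cases hmod : (r + 1 - (3 * m + 1)) % 3 = 0
      · rw [if_pos hmod]
        have e1 : (r + 1 - (3 * m + 1)) / 3 + 1 = (r - (3 * m + 1)) / 3 + 1 + 1 := by omega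
        have e2 : (r + 1 - (3 * m + 1)) / 3 = (r - (3 * m + 1)) / 3 + 1 := by omega
        rw [e1, e2]
        simp [xorUpTo]
      · rw [if_neg hmod]
        have e1 : (r + 1 - (3 * m + 1)) / 3 = (r - (3 * m + 1)) / 3 := by omega
        rw [e1, Bool.not_true, Bool.xor_false]

/-- After the whole comb (`r = 6m`, `m ≥ 1`) the zero-parity is back to `0`. -/
theorem combPar_end {m : ℕ} (hm : 1 ≤ m) (u : Fin m → Bool) : combPar m (ext u) (6 * m) = false := by
  unfold combPar
  rw [if_neg (by omega)]
  have e1 : (6 * m - (3 * m + 1)) / 3 + 1 = m := by omega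
  rw [e1]
  have e2 : xorUpTo (ext u) (m + 1) = xorUpTo (ext u) m := by
    show xor (xorUpTo (ext u) m) (!ext u m) = _
    rw [ext_of_le u le_rfl, Bool.not_true, Bool.xor_false]
  rw [e2, Bool.xor_self]

/-- `xorUpTo (ext u) n` is the tree's prefix zero-parity `zpar u n`. -/
theorem xorUpTo_ext_eq_zpar {m : ℕ} (u : Fin m → Bool) : ∀ {n : ℕ}, n ≤ m → xorUpTo (ext u) n = zpar u n
  | 0, _ => by rw [zpar_zero]; rfl
  | n + 1, h => by
    show xor (xorUpTo (ext u) n) (!ext u n) = _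
    rw [xorUpTo_ext_eq_zpar u (Nat.le_of_succ_le h), zpar_succ u h, ext_of_lt u h]

/-- Prefix XOR, successor step (inside or outside the range). -/
theorem xorUpTo_ext_succ {m : ℕ} (u : Fin m → Bool) : xorUpTo (ext u) (m + 1) = xorUpTo (ext u) m := by
  show xor (xorUpTo (ext u) m) (!ext u m) = _
  rw [ext_of_le u le_rfl, Bool.not_true, Bool.xor_false]

/-- The comb's parity bit `bx u ∈ {0,1}`: `1` iff `u` has an odd number of `false`s. -/
def bx {m : ℕ} (u : Fin m → Bool) : ℕ := if xorUpTo (ext u) (m + 1) = true then 1 else 0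

/-- For odd `m`, `bx u = ev u` (odd number of `false`s iff even number of `true`s). -/
theorem bx_eq_ev {m : ℕ} (hm : Odd m) (u : Fin m → Bool) : bx u = ev u := by
  unfold bx ev
  rw [xorUpTo_ext_succ, xorUpTo_ext_eq_zpar u le_rfl]
  unfold zpar
  have hset : (univ.filter fun j : Fin m => j.val < m ∧ u j = false) = univ.filter fun j : Fin m => u j = false := by
    ext j; simp
  rw [hset]
  have hcard := Finset.card_filter_add_card_filter_not (s := (univ : Finset (Fin m)))
    (fun j : Fin m => u j = true)
  have hneg : (univ.filter fun j : Fin m => ¬ u j = true) = univ.filter fun j : Fin m => u j = false := by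
    ext j; simp
  rw [hneg, Finset.card_univ, Fintype.card_fin] at hcard
  obtain ⟨c, hc⟩ := hm
  by_cases ho : Odd (univ.filter fun j : Fin m => u j = true).card
  · rw [if_neg, if_pos ho]
    · obtain ⟨d, hd⟩ := ho
      simp only [decide_eq_true_eq]
      omega
  · rw [if_pos, if_neg ho]
    rw [Nat.not_odd_iff_even] at ho
    obtain ⟨d, hd⟩ := ho
    simp only [decide_eq_true_eq]
    omega

/-- `Σ_{r < 3m} f (r / 3) = 3 · Σ_{b < m} f b`. -/
theorem sum_range_div_three (f : ℕ → ℕ) (m : ℕ) :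
    ∑ r ∈ range (3 * m), f (r / 3) = 3 * ∑ b ∈ range m, f b := by
  induction m with
  | zero => simp
  | succ m ih =>
    rw [show 3 * (m + 1) = 3 * m + 1 + 1 + 1 by ring, sum_range_succ, sum_range_succ, sum_range_succ, ih,
      sum_range_succ]
    have e0 : 3 * m / 3 = m := by omega
    have e1 : (3 * m + 1) / 3 = m := by omega
    have e2 : (3 * m + 1 + 1) / 3 = m := by omega
    rw [e0, e1, e2]; ring

/-- The comb's contribution to `W`. -/
def combSum (m : ℕ) (y : ℕ → Bool) : ℕ := ∑ r ∈ range (6 * m + 1), (if combPar m y r = true then 1 else 0)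

/-- **Three-block law**: the comb's contribution to `W` is its parity bit modulo `3`. -/
theorem combSum_mod_three (m : ℕ) (y : ℕ → Bool) :
    combSum m y % 3 = (if xorUpTo y (m + 1) = true then 1 else 0) := by
  unfold combSum
  rw [show 6 * m + 1 = (3 * m + 1) + 3 * m by ring, sum_range_add, sum_range_succ]
  have hA : ∑ r ∈ range (3 * m), (if combPar m y r = true then 1 else 0) =
      ∑ r ∈ range (3 * m), (fun b => if xorUpTo y (b + 1) = true then 1 else 0) (r / 3) := by
    refine sum_congr rfl fun r hr => ?_
    rw [mem_range] at hr
    simp only [combPar, if_pos (show r ≤ 3 * m by omega)]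
  have hB : ∑ q ∈ range (3 * m), (if combPar m y (3 * m + 1 + q) = true then 1 else 0) =
      ∑ q ∈ range (3 * m), (fun b => if xor (xorUpTo y (m + 1)) (xorUpTo y (b + 1)) = true then 1 else 0)
        (q / 3) := by
    refine sum_congr rfl fun q hq => ?_
    have e : 3 * m + 1 + q - (3 * m + 1) = q := by omega
    simp only [combPar, if_neg (show ¬ 3 * m + 1 + q ≤ 3 * m by omega), e]
  rw [hA, hB, sum_range_div_three (fun b => if xorUpTo y (b + 1) = true then 1 else 0) m,
    sum_range_div_three (fun b => if xor (xorUpTo y (m + 1)) (xorUpTo y (b + 1)) = true then 1 else 0) m]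
  have e3 : 3 * m / 3 + 1 = m + 1 := by omega
  simp only [combPar, if_pos (le_refl (3 * m)), e3]
  split <;> omega


end Comb

end Summit.QuantumAdvantage.QuantumAdvantage.Theorems.RingSparseActive
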